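import Mathlib
import HarnessLib
import Summits.HubbardSuperconductivity.HubbardSuperconductivity.Theorems.KLProgrammeKLRegimeEngineV8DefsQ4
import Summits.HubbardSuperconductivity.HubbardSuperconductivity.Theorems.KLProgrammeKLRegimeEngineV8DefsG2
import Summits.HubbardSuperconductivity.HubbardSuperconductivity.Theorems.KLProgrammeKLRegimeEngineScaleZeroValuesExplicit
import Summits.HubbardSuperconductivity.HubbardSuperconductivity.Theorems.KLProgrammeKLRegimeSplitEngineV9

/-!
# v5 `Q`-part of the engine package: `CR := max (2^{60}·Psq²·Rsq²) (klScaleZeroValC R)` — the scale-`0` VALUES size by NAME, next to v4's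
# `CE := max (…) (klE1CE P)` (cell gate-hubbard-kl; seat p3 g6, the engine row's (E2)₀/values prover; gen-5 ENGINE child stmt-HubbardSuperconductivity-19918)

Why.  The pair-amplitude ultraviolet clause of `stub_engine_scale0` ((E2-v9).1 / (E2′-S2 UV) at `n = 0`) is proved on every admissible frame
by `pairLadderStepAtV8_zero_of_klEng` (`…ScaleZeroValuesExplicit`, p489206) under two package numbers: `klScaleZeroThetaC R·U ≤ 1/2`
(DISCHARGED under the existing `klEngU₀3` by k3c2-p1's `klScaleZeroThetaC_mul_le_half_of_le_klEngU₀3`) and **`klScaleZeroValC R ≤ 4·Q.CR·P.Klam²`**.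
`klScaleZeroValC R ≈ 2^{98}·(Gfr-growth)` exceeds v3/v4's `4·CR·Klam² = 2^{62}·Psq²·Rsq²·Klam²` for small `P, R`, so — exactly as v4 did for
`CE` — the repair is a package NUMBER on the ENGINE's own `∃`-witness: **`klEngQ5 P R`** = `klEngQ4 P R` with
`CR := max (2^{60}·klEngPsq P²·klEngRsq R²) (klScaleZeroValC R)` (then `4·CR·Klam² ≥ CR ≥ klScaleZeroValC R` since `Klam ≥ 1`).  Every other
field is v4's (`CE` keeps `klE1CE P`); the thresholds `klEngC₃3 / klEngU₀3 / klEngL₃ / klEngM₃` and the `G`-part are UNCHANGED.  The other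
children read `Q` universally with their `U₀` AFTER `Q` (`CountertermP2`, `VolumeLimitP2`, …), so a larger `CR` costs nothing proved.

* `klEngQ5`, `klEngQ5_wf`; dominance `klEngQ3_CR_le_klEngQ5_CR`, `klEngQ4_CR_le_klEngQ5_CR`, `klScaleZeroValC_le_klEngQ5_CR`,
  `klEngQ5_CE` (= v4's), the v3 field equalities, `deltaUV_absorbed5`;
* `kernelNormsV4_zero_klEngQ5` — k3c2-p1's (E1-v4)₀ conjunct transported (same `CE`);
* **`pairLadderStepAtV9_zero_klEngQ5`** — the VALUES conjuncts `PairLadderStepAtV9 … (klEngQ5 P R) … 0 ∧ QuarticValueUVAtS2 … 0` under EXACTLY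
  the binders of `stub_engine_scale0` (G-part `klEngGeo3`), sorry-free: the second and third conjuncts of the stub at this package.
-/

noncomputable section

namespace Summit.HubbardSuperconductivity.HubbardSuperconductivity.Theorems.EngineV8

set_option linter.dupNamespace false -- summit = problem name (single-conjunct summit), D-0017

open Real Finset Literature.MathematicalPhysics.QuantumLattice Literature.Probability.LatticeModels
open Summit.HubbardSuperconductivity.HubbardSuperconductivity.Theorems.KLRegimeSplit
open Summit.HubbardSuperconductivity.HubbardSuperconductivity.Theorems.KLProgrammeLegKernels

/-- **`klEngQ5 P R` — the engine's constants `Q`, v5**: as `klEngQ4 P R` except `CR := max (2^{60}·klEngPsq²·klEngRsq²) (klScaleZeroValC R)`. -/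
def klEngQ5 (P : SplitConsts) (R : RenConsts) : EngConsts where
  CE := max (2 ^ 60 * klEngPsq P ^ 2 * klEngRsq R ^ 2) (klE1CE P)
  CR := max (2 ^ 60 * klEngPsq P ^ 2 * klEngRsq R ^ 2) (klScaleZeroValC R)
  c0 := 2 ^ 60 * klEngPsq P ^ 2 * klEngRsq R ^ 2
  cE4 := 2 ^ 60 * klEngPsq P ^ 2 * klEngRsq R ^ 2
  S' := fun _ => 2 ^ 60 * klEngPsq P ^ 2 * klEngRsq R ^ 2
  Bf := 2 ^ 60 * klEngPsq P ^ 2 * klEngRsq R ^ 2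
  SL := 2 ^ 60 * klEngPsq P ^ 2 * klEngRsq R ^ 2
  CL := fun β n => 2 ^ 60 * klEngPsq P ^ 2 * klEngRsq R ^ 2 * (β ^ 2 + 1) * (4 : ℝ) ^ n
  L0 := fun β => 2 ^ 10 * (⌈|β|⌉₊ + 1) ^ 2
  M0 := fun β L => 2 ^ 10 * (⌈|β|⌉₊ + 1) ^ 2 * (L + 1) ^ 2

/-- `klEngQ5 P R` is well formed (unconditionally). -/
theorem klEngQ5_wf (P : SplitConsts) (R : RenConsts) : (klEngQ5 P R).WF := by
  have h2 : (0 : ℝ) ≤ 2 ^ 60 := pow_nonneg zero_le_two 60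
  have hc : (0 : ℝ) ≤ 2 ^ 60 * klEngPsq P ^ 2 * klEngRsq R ^ 2 :=
    mul_nonneg (mul_nonneg h2 (sq_nonneg _)) (sq_nonneg _)
  have hCE : (0 : ℝ) ≤ max (2 ^ 60 * klEngPsq P ^ 2 * klEngRsq R ^ 2) (klE1CE P) := le_max_of_le_left hc
  have hCR : (0 : ℝ) ≤ max (2 ^ 60 * klEngPsq P ^ 2 * klEngRsq R ^ 2) (klScaleZeroValC R) := le_max_of_le_left hc
  refine ⟨hCE, hCR, hc, hc, fun _ => hc, hc, hc, fun β n => ?_⟩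
  show (0 : ℝ) ≤ 2 ^ 60 * klEngPsq P ^ 2 * klEngRsq R ^ 2 * (β ^ 2 + 1) * (4 : ℝ) ^ n
  exact mul_nonneg (mul_nonneg hc (by nlinarith [sq_nonneg β])) (pow_nonneg (by norm_num) n)

/-! ## Dominance: everything proved at v3 / v4 transfers -/

/-- `CE` is that of v4 (it carries `klE1CE P`). -/
theorem klEngQ5_CE (P : SplitConsts) (R : RenConsts) : (klEngQ5 P R).CE = (klEngQ4 P R).CE := rfl

/-- `klE1CE P ≤ (klEngQ5 P R).CE`. -/
theorem klE1CE_le_klEngQ5_CE (P : SplitConsts) (R : RenConsts) : klE1CE P ≤ (klEngQ5 P R).CE := le_max_right _ _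

/-- `(klEngQ3 P R).CR ≤ (klEngQ5 P R).CR`. -/
theorem klEngQ3_CR_le_klEngQ5_CR (P : SplitConsts) (R : RenConsts) : (klEngQ3 P R).CR ≤ (klEngQ5 P R).CR := le_max_left _ _

/-- `(klEngQ4 P R).CR ≤ (klEngQ5 P R).CR`. -/
theorem klEngQ4_CR_le_klEngQ5_CR (P : SplitConsts) (R : RenConsts) : (klEngQ4 P R).CR ≤ (klEngQ5 P R).CR := le_max_left _ _

/-- **`klScaleZeroValC R ≤ (klEngQ5 P R).CR`** — the values-clause package condition holds at v5. -/
theorem klScaleZeroValC_le_klEngQ5_CR (P : SplitConsts) (R : RenConsts) : klScaleZeroValC R ≤ (klEngQ5 P R).CR := le_max_right _ _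

/-- **`klScaleZeroValC R ≤ 4·(klEngQ5 P R).CR·Klam²`** for `1 ≤ Klam` (the `hcmp` of `pairLadderStepAtV8_zero_of_klEng`). -/
theorem klScaleZeroValC_le_four_mul_klEngQ5_CR {P : SplitConsts} (hP : 1 ≤ P.Klam) (R : RenConsts) :
    klScaleZeroValC R ≤ 4 * (klEngQ5 P R).CR * P.Klam ^ 2 := by
  have h1 := klScaleZeroValC_le_klEngQ5_CR P R
  have hCR : 0 ≤ (klEngQ5 P R).CR := (klEngQ5_wf P R).2.1
  have hK : 1 ≤ P.Klam ^ 2 := one_le_pow₀ hP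
  nlinarith

/-- `c0` is that of v3. -/
theorem klEngQ5_c0 (P : SplitConsts) (R : RenConsts) : (klEngQ5 P R).c0 = (klEngQ3 P R).c0 := rfl

/-- `cE4` is that of v3. -/
theorem klEngQ5_cE4 (P : SplitConsts) (R : RenConsts) : (klEngQ5 P R).cE4 = (klEngQ3 P R).cE4 := rfl

/-- `S'` is that of v3. -/
theorem klEngQ5_S' (P : SplitConsts) (R : RenConsts) : (klEngQ5 P R).S' = (klEngQ3 P R).S' := rfl

/-- `Bf` is that of v3. -/
theorem klEngQ5_Bf (P : SplitConsts) (R : RenConsts) : (klEngQ5 P R).Bf = (klEngQ3 P R).Bf := rfl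

/-- `SL` is that of v3. -/
theorem klEngQ5_SL (P : SplitConsts) (R : RenConsts) : (klEngQ5 P R).SL = (klEngQ3 P R).SL := rfl

/-- `CL` is that of v3. -/
theorem klEngQ5_CL (P : SplitConsts) (R : RenConsts) : (klEngQ5 P R).CL = (klEngQ3 P R).CL := rfl

/-- `L0` is that of v3. -/
theorem klEngQ5_L0 (P : SplitConsts) (R : RenConsts) : (klEngQ5 P R).L0 = (klEngQ3 P R).L0 := rfl

/-- `M0` is that of v3. -/
theorem klEngQ5_M0 (P : SplitConsts) (R : RenConsts) : (klEngQ5 P R).M0 = (klEngQ3 P R).M0 := rfl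

/-- The Δ-UV absorption inequality at the v5 package: `32·Gfr 0 + 4·cr ≤ (klEngQ5 P R).CR`. -/
theorem deltaUV_absorbed5 (P : SplitConsts) (R : RenConsts) : 32 * R.Gfr 0 + 4 * R.cr ≤ (klEngQ5 P R).CR :=
  (deltaUV_absorbed3 P R).trans (klEngQ3_CR_le_klEngQ5_CR P R)

/-! ## The scale-`0` conjuncts of `stub_engine_scale0` at the v5 package -/

/-- `U ≤ klEngU₀3 P R c ⟹ U ≤ 1`. -/
theorem le_one_of_le_klEngU₀3 {P : SplitConsts} {R : RenConsts} {c U : ℝ} (hU₀ : U ≤ klEngU₀3 P R c) : U ≤ 1 := by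
  refine hU₀.trans ?_
  rw [klEngU₀3]
  have hp := one_le_klEngPsq P
  have hr := one_le_klEngRsq R
  have hden : (1 : ℝ) ≤ (2 : ℝ) ^ 120 * klEngPsq P ^ 2 * klEngRsq R ^ 4 * (c ^ 2 + 1) := by
    have h1 : (1 : ℝ) ≤ (2 : ℝ) ^ 120 := by norm_num
    have h2 : (1 : ℝ) ≤ klEngPsq P ^ 2 := one_le_pow₀ hp
    have h3 : (1 : ℝ) ≤ klEngRsq R ^ 4 := one_le_pow₀ hr
    have h4 : (1 : ℝ) ≤ c ^ 2 + 1 := by nlinarith [sq_nonneg c]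
    calc (1 : ℝ) = 1 * 1 * 1 * 1 := by ring
      _ ≤ _ := by gcongr
  exact (div_le_one (by positivity)).2 hden

/-- **(E1-v4)₀ at `klEngQ5`** (k3c2-p1's conjunct, same `CE` as v4), under exactly the binders of `stub_engine_scale0`. -/
theorem kernelNormsV4_zero_klEngQ5 (P : SplitConsts) (R : RenConsts) (c : ℝ) (hP : P.WF) (hR : R.WF2) (hc : 0 < c)
    (hc₃ : c ≤ klEngC₃3 P R) (μ : ℝ) (hμ : μ ∈ klWindowC) (U : ℝ) (hU : 0 < U) (hU₀ : U ≤ klEngU₀3 P R c) (β : ℝ)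
    (hβ : klBetaMin ≤ β) (hβc : β ≤ Real.exp (c / U ^ 2)) (K : TrigPolyC4v) (hK : FrameOK R U (nScales β) μ K) (L M : ℕ)
    [NeZero L] [NeZero M] (hL : klEngL₃ β U ≤ L) (hM : klEngM₃ β U L ≤ M) :
    KernelNormsV4 L M P (klEngQ5 P R) β U μ K 0 := by
  have _ := hc; have _ := hc₃; have _ := hβc
  exact kernelNormsV4_zero_of_klEng_of_le_CE hR.wf (lt_of_lt_of_le one_pos hP.1) hU (le_one_of_le_klEngU₀3 hU₀) hU₀ hK hμ hβ hL hM
    (klE1CE_le_klEngQ5_CE P R)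

/-- **The VALUES conjuncts of `stub_engine_scale0` at `klEngQ5` — (E2-v9).1 and (E2′-S2 UV) at `n = 0`** — under exactly the stub's binders
(G-part `klEngGeo3`): `PairLadderStepAtV9 … (klEngQ5 P R) … 0 ∧ QuarticValueUVAtS2 … (klEngQ5 P R) … 0`.  Proof: `pairLadderStepAtV8_zero_of_klEng`
(p3 g6) with `θ`-number from `klScaleZeroThetaC_mul_le_half_of_le_klEngU₀3` (k3c2-p1) and `klScaleZeroValC R ≤ 4·CR·Klam²` from the v5 `CR`;
V8 ↔ V9 at `n = 0` by `pairLadderStepAtV9_iff_V8_zero`. -/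
theorem pairLadderStepAtV9_zero_klEngQ5 (P : SplitConsts) (R : RenConsts) (c : ℝ) (hP : P.WF) (hR : R.WF2) (hc : 0 < c)
    (hc₃ : c ≤ klEngC₃3 P R) (μ : ℝ) (hμ : μ ∈ klWindowC) (U : ℝ) (hU : 0 < U) (hU₀ : U ≤ klEngU₀3 P R c) (β : ℝ)
    (hβ : klBetaMin ≤ β) (hβc : β ≤ Real.exp (c / U ^ 2)) (K : TrigPolyC4v) (hK : FrameOK R U (nScales β) μ K) (L M : ℕ)
    [NeZero L] [NeZero M] (hL : klEngL₃ β U ≤ L) (hM : klEngM₃ β U L ≤ M) :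
    PairLadderStepAtV9 L M klEngGeo3 P (klEngQ5 P R) β U μ K 0 ∧ QuarticValueUVAtS2 L M klEngGeo3 P (klEngQ5 P R) β U μ K 0 := by
  have _ := hc; have _ := hc₃; have _ := hβc; have _ := hμ
  obtain ⟨hE2, hUV⟩ := pairLadderStepAtV8_zero_of_klEng (L := L) (M := M) (G := klEngGeo3) (Q := klEngQ5 P R) klEngGeo3_wf hP
    (klEngQ5_wf P R) hR.wf hU (le_one_of_le_klEngU₀3 hU₀) hβ hK hL hM
    (klScaleZeroThetaC_mul_le_half_of_le_klEngU₀3 hR.wf hU hU₀) (klScaleZeroValC_le_four_mul_klEngQ5_CR hP.1 R)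
  exact ⟨(pairLadderStepAtV9_iff_V8_zero klEngGeo3 P (klEngQ5 P R) β U μ K).2 hE2, hUV⟩

end Summit.HubbardSuperconductivity.HubbardSuperconductivity.Theorems.EngineV8

end
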